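import Mathlib
import Literature.NumberTheory.LFunctions.Zhang2022.SkeletonEvalRelE
import HarnessLib

/-!
# Zhang (2022), typed skeleton — the 𝔢-parametrised §18 endgame: edges (RT-05, proof file)

Topic `Literature/NumberTheory/LFunctions/Zhang2022` (Landau–Siegel audit tree; verdict-neutral).
Y. Zhang, *Discrete mean estimates and the Landau–Siegel zero*, arXiv:2211.02515v1 (2022)
[Zhang2022LandauSiegel] — **an unrefereed manuscript under adjudication.** Companion of the statement
file `SkeletonEvalRelE` (ZHANG-L re-type RT-05, zl-lead R-28): the three constant-AGNOSTIC edges of the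
§2 p. 6 endgame re-proved VERBATIM at a parameter value `e1pp : ℕ → ℂ` of Lemma 15.1's `e″_{1j}`
(`frake ↦ frakeE e1pp`, `frakc3 ↦ frakc3E e1pp`; no numerical property of `e1pp` is used):

* `eval181RelE_of_parts` — (18.1)ᴿ ⇐ (12.17)ᴿ, (13.7)+(13.11)ᴿ, (15.24)ᴿ, (16.17)ᴿ, (17.10)ᴿ (exact linear
  algebra; only `𝔠₃`'s definitional shape `−i(3𝔢₁+3𝔢₂+𝔢₃+𝔢₀) + e₁* + 2e₂*` enters), copy of
  `SkeletonEvalRel.eval181Rel_of_parts`;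
* `ineq232E_of_evals_with` — §18 p. 36 «(8.23), (9.7) and (18.1) yield (2.32)» with `𝔠₂ := k`, copy of
  `SkeletonEval97cL102Rel.ineq232_of_evals_with` (the margin hypothesis `Margin232WithE e1pp k` is consumed
  POSITIVELY: `m = 0.001 − (𝔠₁ + k + 2(Re 𝔠₃ + 10⁻⁵)) > 0`, `ε = m·a₀/(8+4a₀)`);
* `theorem1E_of_evaluations_with` — Theorem 1 ⇐ the evaluations + that margin (the 𝔢-free pieces
  `prop24_of_eval`, `prop26_of_evals_with`, `ineq233_of_bound` unchanged);
* `eval181Rel_of_partsE` — consistency: the banked edge is the `e1ppj` instance (by the `Iff.rfl` bridges).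

What is NOT asserted: any node; Theorem 1 (its margin hypothesis is refuted at `e1ppj` and at `e1ppD`);
anything about Landau–Siegel zeros.

## References

* Y. Zhang, arXiv:2211.02515v1 (2022): (18.1) p. 99, §18 p. 99–100, §2 p. 6.
  [cite: Zhang2022LandauSiegel, §18 (18.1)]
-/

noncomputable section

open Complex Real

namespace Literature.NumberTheory.LFunctions.Zhang2022.Skeleton

/-! ## The constant-agnostic edges, at the parameter -/

section Edges

variable {e1pp : ℕ → ℂ} {c' : ℝ} {k : ℝ}

/-- **(18.1), relative, from its five parts, 𝔢 parametrised** — the proof of `eval181Rel_of_parts`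
verbatim (`Ξ₁₃ = Ξ₁₄ + Ξ₁₅` and `𝔠₃ = −i(3𝔢₁+3𝔢₂+𝔢₃+𝔢₀) + e₁* + 2e₂*` with `𝔢ⱼ := frakeE e1pp j`).
[cite: Zhang2022LandauSiegel, §18 (18.1)] -/
theorem eval181RelE_of_parts (h1217 : Eval1217Rel c') (h137 : Eval137Rel c')
    (h1524 : Eval1524RelE e1pp c') (h1617 : Eval1617RelE e1pp c') (h1710 : Eval1710RelE e1pp c') :
    Eval181RelE e1pp c' := by
  intro ε hε
  have hε5 : 0 < ε / 5 := by positivity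
  obtain ⟨D₀, h⟩ := ((((h1217 _ hε5).and (h137 _ hε5)).and (h1524 _ hε5)).and (h1617 _ hε5)).and
    (h1710 _ hε5)
  refine ⟨D₀, fun D _ χ hD hq hp hA => ?_⟩
  obtain ⟨⟨⟨⟨e1217, e137⟩, e1524⟩, e1617⟩, e1710⟩ := h D χ hD hq hp
  have g1217 := e1217 hA
  have g137 := e137 hA
  have g1524 := e1524 hA
  have g1617 := e1617 hA
  have g1710 := e1710 hA
  have key : xi13 c' χ - frakc3E e1pp * frakA χ * frakP D =
      (xi14 c' χ + I * (Phi1 c' χ + Phi2 c' χ - Phi3 c' χ)) +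
      (-I) * (Phi1 c' χ - (frakeE e1pp 1 + 2 * frakeE e1pp 2 + frakeE e1pp 3) * frakA χ * frakP D) +
      (-I) * (Phi2 c' χ - (frakeE e1pp 1 + frakeE e1pp 2) * frakA χ * frakP D) +
      I * (Phi3 c' χ + (frake0 + frakeE e1pp 1) * frakA χ * frakP D) +
      (xi15 c' χ - (e1star + 2 * e2star) * frakA χ * frakP D) := by
    rw [xi13_eq_xi14_add_xi15, frakc3E]
    ring
  rw [key]
  have nI : ‖(-I : ℂ)‖ = 1 := by simp
  calc ‖(xi14 c' χ + I * (Phi1 c' χ + Phi2 c' χ - Phi3 c' χ)) +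
        (-I) * (Phi1 c' χ - (frakeE e1pp 1 + 2 * frakeE e1pp 2 + frakeE e1pp 3) * frakA χ * frakP D) +
        (-I) * (Phi2 c' χ - (frakeE e1pp 1 + frakeE e1pp 2) * frakA χ * frakP D) +
        I * (Phi3 c' χ + (frake0 + frakeE e1pp 1) * frakA χ * frakP D) +
        (xi15 c' χ - (e1star + 2 * e2star) * frakA χ * frakP D)‖
      ≤ ‖xi14 c' χ + I * (Phi1 c' χ + Phi2 c' χ - Phi3 c' χ)‖ +
        ‖(-I) * (Phi1 c' χ - (frakeE e1pp 1 + 2 * frakeE e1pp 2 + frakeE e1pp 3) * frakA χ * frakP D)‖ +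
        ‖(-I) * (Phi2 c' χ - (frakeE e1pp 1 + frakeE e1pp 2) * frakA χ * frakP D)‖ +
        ‖I * (Phi3 c' χ + (frake0 + frakeE e1pp 1) * frakA χ * frakP D)‖ +
        ‖xi15 c' χ - (e1star + 2 * e2star) * frakA χ * frakP D‖ := by
          refine le_trans (norm_add_le _ _) ?_
          gcongr
          refine le_trans (norm_add_le _ _) ?_
          gcongr
          refine le_trans (norm_add_le _ _) ?_
          gcongr
          exact norm_add_le _ _
    _ ≤ ε / 5 * (frakA χ + 1) * frakP D + ε / 5 * (frakA χ + 1) * frakP D +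
        ε / 5 * (frakA χ + 1) * frakP D + ε / 5 * (frakA χ + 1) * frakP D +
        (1e-5 * frakA χ * frakP D + ε / 5 * (frakA χ + 1) * frakP D) := by
          rw [norm_mul, norm_mul, norm_mul, nI, Complex.norm_I, one_mul, one_mul, one_mul]
          gcongr
    _ = 1e-5 * frakA χ * frakP D + ε * (frakA χ + 1) * frakP D := by ring

/-- **§18 p. 36 with `𝔠₂ := k` and `𝔠₃ := frakc3E e1pp`: "(8.23), (9.7) and (18.1) yield (2.32)"** —
the proof of `ineq232_of_evals_with` verbatim (`ε = m·a₀/(8 + 4a₀)`,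
`m = 0.001 − (𝔠₁ + k + 2(Re 𝔠₃ + 10⁻⁵))`; the margin hypothesis is consumed POSITIVELY).
[cite: Zhang2022LandauSiegel, §18 p. 36] -/
theorem ineq232E_of_evals_with (h22 : Prop22i) (h23 : Lemma23 c') (hprim : PsiChiPrimitive)
    (h823 : Eval823 c') (h97 : Eval97With c' k) (h181 : Eval181RelE e1pp c')
    (hm : Margin232WithE e1pp k) (ha : FrakALowerBound) : Ineq232 c' := by
  obtain ⟨a₀, ha₀, ha⟩ := ha
  obtain ⟨D₁, hP⟩ := frakP_eventually_pos
  rw [Margin232WithE] at hm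
  set m : ℝ := 0.001 - (frakc1.re + k + 2 * ((frakc3E e1pp).re + 1e-5)) with hm_def
  have hm0 : 0 < m := by rw [hm_def]; linarith
  set ε : ℝ := m * a₀ / (8 + 4 * a₀) with hε
  have hε0 : 0 < ε := by positivity
  have hεid : ε * (8 + 4 * a₀) = m * a₀ := by rw [hε]; field_simp
  obtain ⟨D₀, h⟩ := ((((h22.and h23).and (h823 ε hε0)).and (h97 ε hε0)).and (h181 ε hε0)).and ha
  refine ⟨max (max D₀ D₁) 3, fun D _ χ hD hq hp hA => ?_⟩
  have hD3 : 3 ≤ D := le_trans (le_max_right _ _) hD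
  have hD₀ : D₀ ≤ D := le_trans (le_trans (le_max_left _ _) (le_max_left _ _)) hD
  have hD₁ : D₁ ≤ D := le_trans (le_trans (le_max_right _ _) (le_max_left _ _)) hD
  obtain ⟨⟨⟨⟨⟨h22', h23'⟩, h823'⟩, h97'⟩, h181'⟩, ha'⟩ := h D χ hD₀ hq hp
  have hPpos : 0 < frakP D := hP D hD₁
  have haa : a₀ ≤ frakA χ := ha' hA
  have e1 := abs_le.mp (h823' hA)
  have e2 := abs_le.mp (h97' hA)
  have e3 : |(xi13 c' χ).re - (frakc3E e1pp).re * frakA χ * frakP D| ≤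
      1e-5 * frakA χ * frakP D + ε * (frakA χ + 1) * frakP D := by
    have h3 := h181' hA
    have : (xi13 c' χ - frakc3E e1pp * frakA χ * frakP D).re =
        (xi13 c' χ).re - (frakc3E e1pp).re * frakA χ * frakP D := by
      simp [Complex.sub_re, Complex.mul_re]
    rw [← this]
    exact le_trans (Complex.abs_re_le_norm _) h3
  have e3' := abs_le.mp e3
  rw [xi1_eq_of χ hD3 h23' h22' (fun x => hprim D χ x hD3 hp)]
  have hA0 : 0 < frakA χ := lt_of_lt_of_le ha₀ haa
  have h4 : ε * (4 + 2 * frakA χ) * frakP D < m * frakA χ * frakP D := by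
    have hlt : ε * (4 + 2 * frakA χ) < m * frakA χ := by
      have h8 : (0 : ℝ) < 8 + 4 * a₀ := by positivity
      have key : ε * (4 + 2 * frakA χ) * (8 + 4 * a₀) < m * frakA χ * (8 + 4 * a₀) := by
        calc ε * (4 + 2 * frakA χ) * (8 + 4 * a₀) = m * a₀ * (4 + 2 * frakA χ) := by
              rw [mul_assoc, mul_comm (4 + 2 * frakA χ), ← mul_assoc, hεid]
          _ = m * (4 * a₀ + 2 * a₀ * frakA χ) := by ring
          _ < m * (8 * frakA χ + 4 * a₀ * frakA χ) := by
              refine mul_lt_mul_of_pos_left ?_ hm0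
              nlinarith
          _ = m * frakA χ * (8 + 4 * a₀) := by ring
      exact lt_of_mul_lt_mul_right key h8.le
    exact mul_lt_mul_of_pos_right hlt hPpos
  nlinarith [e1.2, e2.2, e3'.2]

/-- **Theorem 1 from the evaluations, (9.7) read with `𝔠₂ := k`, (18.1)ᴿ and the margin at
`𝔠₃ := frakc3E e1pp`** (the endgame `theorem1_of_evaluations_with` re-run with
`ineq232E_of_evals_with`; `prop24_of_eval`, `prop26_of_evals_with`, `ineq233_of_bound` are 𝔢-free and
unchanged). [cite: Zhang2022LandauSiegel, §2 p. 6, §18] -/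
theorem theorem1E_of_evaluations_with (h22 : Prop22i) (h23 : Lemma23 c')
    (h1017 : Eval1017 c') (h823 : Eval823 c') (h97 : Eval97With c' k) (h181 : Eval181RelE e1pp c')
    (hm : Margin232WithE e1pp k) (h183 : Bound183 c') (h111 : Eval111 c') : Theorem1 :=
  have ha : FrakALowerBound := frakALowerBound_holds
  have hprim : PsiChiPrimitive := psiChiPrimitive_holds
  theorem1_of_props h22 h23 (prop24_of_eval h1017 Prop24Main_holds ha)
    (prop25_of_ineqs h22 h23 hprim (ineq232E_of_evals_with h22 h23 hprim h823 h97 h181 hm ha)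
      (ineq233_of_bound h183 ha))
    (prop26_of_evals_with h22 h23 hprim h111 h97 ha)

/-- The banked edge is the `e1ppj` instance of the parametrised one (consistency check, by the
definitional bridges). [cite: Zhang2022LandauSiegel, §18 (18.1)] -/
theorem eval181Rel_of_partsE (h1217 : Eval1217Rel c') (h137 : Eval137Rel c')
    (h1524 : Eval1524Rel c') (h1617 : Eval1617Rel c') (h1710 : Eval1710Rel c') : Eval181Rel c' :=
  (eval181RelE_e1ppj_iff c').mp
    (eval181RelE_of_parts h1217 h137 ((eval1524RelE_e1ppj_iff c').mpr h1524)
      ((eval1617RelE_e1ppj_iff c').mpr h1617) ((eval1710RelE_e1ppj_iff c').mpr h1710))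

end Edges

end Literature.NumberTheory.LFunctions.Zhang2022.Skeleton
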